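import Summits.BirchSwinnertonDyer.Rank1Residual.Additive.QuadraticBaseChangeCanonicalModelSumFibre
import Summits.BirchSwinnertonDyer.Rank1Residual.AdditivePotMult.QuadraticBaseChangeOddTamagawaAdditiveWithTwo
import Literature.NumberTheory.EllipticCurves.LFunctionPrimeCoeff
import Literature.NumberTheory.EllipticCurves.RootNumberTwistProofs
import Literature.NumberTheory.DiophantineGeometry.KodairaSymbolUnramifiedBaseChangeProofs
import HarnessLib

/-!
# The canonical-model identities of Milne's quadratic quotient on population S₃ (additive places
# prime to `d_K` allowed), every odd `p`, NO `hA` (row T-MIL-CAN FILE 4; seat n1011-p16 GEN 10)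

HONEST FRAMING (cell `b2b-bsdres`, run/shared/lean/b2b/bsd-rank1-residual/, verbatim in every
file): the goal of the cell is to DELETE the COMBINATION-SHAPED residual classes of the
Birch–Swinnerton-Dyer formula for ALL analytic-rank `≤ 1` elliptic curves over `ℚ` — "full BSD
formula for every rank `≤ 1` curve in class `C`" assembled STRICTLY from published theorems — so
that the rank-`≤ 1` remainder becomes exactly the CONSTRUCTION-SHAPED classes, which are TYPED
(missing-input `Prop`s), NOT attempted. This is not "finishing BSD". X3 / X4 are RESEARCH ROUTES;
they stay CONSTRUCTION-SHAPED; nothing is booked by this file; no mark / label moved. THEOREMS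
ONLY: no definition, no named fact, no `sorry`.

## What

FILE 3 (`QuadraticBaseChangeCanonicalModelSumFibre`) states the three canonical-model identities
from the per-place fibre identities (T) as a hypothesis `hT`.  n1011-p01's T-MIL-3 H-5a
(`QuadraticBaseChangeOddTamagawaAdditiveWithTwo`, consuming row T-MIL-B2 at an inert `2` of type
IV/IV*) proves (T) at every place for every odd `p` on the population `hS` = S₁ ∪ S₂ ∪ S₃ with the
sole proviso `p = 3 → ℓ ≠ 3`, CONDITIONAL on A233 at `(v, ·)` — and row T-A233 made A233 a THEOREM
(`Literature.NumberTheory.DiophantineGeometry.UnramifiedBaseChange.kodairaSymbolAt_baseChange_of_ramificationIdx_eq_one_holds`).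
Feeding both in:

* `sumFibre_of_addv_oddPrime` — (T) at every place on `hS`, NO `hA`;
* `sumFibre_of_natAbs_discr_eq` — (T) at EVERY place with NO local hypothesis when `|d_K| = p` and
  `V` is good or multiplicative at `p` (the in-class fields `ℚ(√p*)`, e.g. `ℚ(ζ₃) = ℚ(√−3)` at
  `p = 3`): every additive place of `V` has residue characteristic `≠ p`, hence prime to `d_K`;
* `padicValRat_modifiedTamagawaProduct_baseChange_eq_of_addv_oddPrime`,
  `padicVal_card_identity_baseChange_anyRank_of_addv_oddPrime`,
  `padicVal_card_identity_baseChange_of_addv_oddPrime` — the three identities on `hS`, NO `hA`, NO Milne.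

HONEST LIMITS: `d_K` odd squarefree; `V` good or multiplicative at `p` for the identities; closes no
class; moves no mark; 0 facts.

References: [cite: Milne1972ArithmeticAV, §1 Thm. 1 and §2] through
[cite: DokchitserDokchitserAnnals2010, §2.1, Lemma 4.14]; [cite: SilvermanAEC2009, Prop. VII.5.4 (a), Exercise 10.16].
-/

noncomputable section

open scoped Classical NumberField

open WeierstrassCurve NumberField IsDedekindDomain Rat.HeightOneSpectrum
  Literature.NumberTheory.DiophantineGeometry
  Literature.NumberTheory.DiophantineGeometry.UnramifiedBaseChange
  Summit.BirchSwinnertonDyer.Rank1Residual.AdditivePotMult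

namespace Summit.BirchSwinnertonDyer.Rank1Residual.Additive

section OddPrime

variable (K : Type) [Field K] [NumberField K]
  (V : WeierstrassCurve ℚ) [V.IsElliptic] [V.IsGloballyMinimal]
  (W : WeierstrassCurve ℚ) [W.IsElliptic] [W.IsGloballyMinimal] (p : ℕ) [hp : Fact p.Prime]

/-- **(T) at every place on population S₃, every odd `p`, NO `hA`**: n1011-p01's per-place theorem
`sum_fibre_padicValNat_localTamagawaNumber_of_semistable_or_addv_of_unramifiedFact_oddPrime` (H-5a) with
its `hA` fed by the THEOREM `kodairaSymbolAt_baseChange_of_ramificationIdx_eq_one_holds` (row T-A233).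
[cite: Milne1972ArithmeticAV, §1 Thm. 1 and §2 (through DokchitserDokchitserAnnals2010, §2.1, proof of Thm. 8)]
[cite: SilvermanAEC2009, Prop. VII.5.4 (a)] -/
theorem sumFibre_of_addv_oddPrime (h2 : Module.finrank ℚ K = 2)
    (hdodd : Odd (NumberField.discr K)) (hdsq : Squarefree (NumberField.discr K))
    {C : VariableChange ℚ} (hC : C • V.quadraticTwist (NumberField.discr K : ℚ) = W) (hp2 : p ≠ 2)
    (hS : ∀ v : HeightOneSpectrum (𝓞 ℚ), V.HasGoodReductionAt v ∨ V.HasMultiplicativeReductionAt v ∨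
      (((primesEquiv v : ℕ) : ℤ) ∣ NumberField.discr K ∧ W.HasMultiplicativeReductionAt v) ∨
      (V.HasAdditiveReductionAt v ∧ ¬ ((primesEquiv v : ℕ) : ℤ) ∣ NumberField.discr K ∧
        (p = 3 → (primesEquiv v : ℕ) ≠ 3)))
    (v : HeightOneSpectrum (𝓞 ℚ)) :
    ∑ w ∈ (HeightOneSpectrum.finite_setOf_under_eq_of_numberField (K := K) v).toFinset,
        padicValNat p (((V.baseChange K).baseChange (w.adicCompletion K)).localTamagawaNumber
          (w.adicCompletionIntegers K)) =
      padicValNat p ((V.baseChange (v.adicCompletion ℚ)).localTamagawaNumber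
          (v.adicCompletionIntegers ℚ)) +
        padicValNat p ((W.baseChange (v.adicCompletion ℚ)).localTamagawaNumber
          (v.adicCompletionIntegers ℚ)) :=
  sum_fibre_padicValNat_localTamagawaNumber_of_semistable_or_addv_of_unramifiedFact_oddPrime V K W h2 hdodd
    hdsq hC p hp2 v (fun w => UnramifiedBaseChange.kodairaSymbolAt_baseChange_of_ramificationIdx_eq_one_holds K v w V) (hS v)

/-- `|d_K| = p` with `p` an odd prime forces `d_K` odd (n1011-p01's remark, cf.
`localHyp_of_natAbs_discr`). -/
private theorem odd_discr_of_natAbs_eq (hp2 : p ≠ 2) (hdK : (NumberField.discr K).natAbs = p) :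
    Odd (NumberField.discr K) := by
  rw [← Int.natAbs_odd, hdK]; exact hp.out.odd_of_ne_two hp2

/-- `|d_K| = p` with `p` prime forces `d_K` squarefree. -/
private theorem squarefree_discr_of_natAbs_eq (hdK : (NumberField.discr K).natAbs = p) :
    Squarefree (NumberField.discr K) := by
  rw [← Int.squarefree_natAbs, hdK]; exact hp.out.prime.squarefree

/-- **(T) at EVERY place with NO local population hypothesis and no hypothesis on `d_K` beyond
`|d_K| = p`** (then `d_K = ±p` is odd squarefree: the fields `ℚ(√p*)`) and `V` is good or multiplicative at `p`: by the local trichotomy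
every place is good, multiplicative, or additive for `V`; an additive place has residue
characteristic `ℓ ≠ p` (`V` is good or multiplicative at the place above `p`,
`hasGood/MultiplicativeReductionAtPrime_iff_…_ringOfIntegers`), hence `ℓ ∤ d_K = ±p` and (at
`p = 3`) `ℓ ≠ 3` — which is H-5a's population. NO `hA` (T-A233), NO Milne.
[cite: Milne1972ArithmeticAV, §1 Thm. 1 and §2 (through DokchitserDokchitserAnnals2010, §2.1, proof of Thm. 8)]
[cite: SilvermanAEC2009, Prop. VII.5.4 (a), VII.5 Prop. 5.1] -/
theorem sumFibre_of_natAbs_discr_eq (h2 : Module.finrank ℚ K = 2)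
    {C : VariableChange ℚ} (hC : C • V.quadraticTwist (NumberField.discr K : ℚ) = W) (hp2 : p ≠ 2)
    (hdK : (NumberField.discr K).natAbs = p)
    (h₀ : V.HasGoodReductionAtPrime p ∨ V.HasMultiplicativeReductionAtPrime p)
    (v : HeightOneSpectrum (𝓞 ℚ)) :
    ∑ w ∈ (HeightOneSpectrum.finite_setOf_under_eq_of_numberField (K := K) v).toFinset,
        padicValNat p (((V.baseChange K).baseChange (w.adicCompletion K)).localTamagawaNumber
          (w.adicCompletionIntegers K)) =
      padicValNat p ((V.baseChange (v.adicCompletion ℚ)).localTamagawaNumber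
          (v.adicCompletionIntegers ℚ)) +
        padicValNat p ((W.baseChange (v.adicCompletion ℚ)).localTamagawaNumber
          (v.adicCompletionIntegers ℚ)) := by
  refine sum_fibre_padicValNat_localTamagawaNumber_of_semistable_or_addv_of_unramifiedFact_oddPrime V K W
    h2 (odd_discr_of_natAbs_eq K p hp2 hdK) (squarefree_discr_of_natAbs_eq K p hdK) hC p hp2 v
    (fun w => UnramifiedBaseChange.kodairaSymbolAt_baseChange_of_ramificationIdx_eq_one_holds K v w V) ?_
  rcases V.hasGoodReductionAt_or_hasMultiplicativeReductionAt_or_hasAdditiveReductionAt v with hg | hm | ha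
  · exact Or.inl hg
  · exact Or.inr (Or.inl hm)
  · -- an additive place is not the place above `p`, hence prime to `d_K = ±p`
    have hℓp : (primesEquiv v : ℕ) ≠ p := by
      intro hvp
      rcases h₀ with hg | hm
      · refine ha.not_hasGoodReductionAt
          ((V.hasGoodReductionAtPrime_iff_hasGoodReductionAt_ringOfIntegers (v := v)).mp ?_)
        subst hvp; exact hg
      · refine ((V.hasMultiplicativeReductionAtPrime_iff_hasMultiplicativeReductionAt_ringOfIntegers
          v).mp ?_).not_hasAdditiveReductionAt ha
        subst hvp; exact hm
    have hnd : ¬ ((primesEquiv v : ℕ) : ℤ) ∣ NumberField.discr K := by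
      intro hdvd
      apply hℓp
      have h1 : (primesEquiv v : ℕ) ∣ (NumberField.discr K).natAbs := Int.natCast_dvd.mp hdvd
      rw [hdK] at h1
      exact (Nat.prime_dvd_prime_iff_eq (primesEquiv v).2 hp.out).mp h1
    exact Or.inr (Or.inr (Or.inr ⟨ha, hnd, fun h3 => by rw [← h3]; exact hℓp⟩))

/-- **`v_p C(V ⊗ K) = v_p(|u_C| · ∏c(V) · ∏c(W))` on S₃, every odd `p`, NO `hA`** (`V` good or
multiplicative at `p`). [cite: Milne1972ArithmeticAV, §1 Thm. 1 and §2 (through DokchitserDokchitserAnnals2010, §2.1, proof of Thm. 8)]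
[cite: DokchitserDokchitserAnnals2010, §1 Notation (arXiv pp. 4–5)] -/
theorem padicValRat_modifiedTamagawaProduct_baseChange_eq_of_addv_oddPrime (h2 : Module.finrank ℚ K = 2)
    (hdodd : Odd (NumberField.discr K)) (hdsq : Squarefree (NumberField.discr K))
    {C : VariableChange ℚ} (hC : C • V.quadraticTwist (NumberField.discr K : ℚ) = W) (hp2 : p ≠ 2)
    (hS : ∀ v : HeightOneSpectrum (𝓞 ℚ), V.HasGoodReductionAt v ∨ V.HasMultiplicativeReductionAt v ∨
      (((primesEquiv v : ℕ) : ℤ) ∣ NumberField.discr K ∧ W.HasMultiplicativeReductionAt v) ∨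
      (V.HasAdditiveReductionAt v ∧ ¬ ((primesEquiv v : ℕ) : ℤ) ∣ NumberField.discr K ∧
        (p = 3 → (primesEquiv v : ℕ) ≠ 3)))
    (h₀ : V.HasGoodReductionAtPrime p ∨ V.HasMultiplicativeReductionAtPrime p) :
    padicValRat p (V.baseChange K).modifiedTamagawaProduct =
      padicValRat p (|(C.u : ℚ)| * (V.tamagawaProduct * W.tamagawaProduct) : ℚ) :=
  padicValRat_modifiedTamagawaProduct_baseChange_eq_of_sumFibre K V W p hdsq hC hp2
    (sumFibre_of_addv_oddPrime K V W p h2 hdodd hdsq hC hp2 hS) h₀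

/-- **The ANY-RANK valuation identity on S₃, every odd `p`, NO `hA`, NO Milne.**
[cite: Milne1972ArithmeticAV, §1 Thm. 1 and §2 (through DokchitserDokchitserAnnals2010, §2.1, proof of Thm. 8)]
[cite: DokchitserDokchitserAnnals2010, Lemma 4.14 (proof)] [cite: SilvermanAEC2009, Exercise 10.16] -/
theorem padicVal_card_identity_baseChange_anyRank_of_addv_oddPrime (h2 : Module.finrank ℚ K = 2)
    (hdodd : Odd (NumberField.discr K)) (hdsq : Squarefree (NumberField.discr K))
    {C : VariableChange ℚ} (hC : C • V.quadraticTwist (NumberField.discr K : ℚ) = W) (hp2 : p ≠ 2)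
    (hS : ∀ v : HeightOneSpectrum (𝓞 ℚ), V.HasGoodReductionAt v ∨ V.HasMultiplicativeReductionAt v ∨
      (((primesEquiv v : ℕ) : ℤ) ∣ NumberField.discr K ∧ W.HasMultiplicativeReductionAt v) ∨
      (V.HasAdditiveReductionAt v ∧ ¬ ((primesEquiv v : ℕ) : ℤ) ∣ NumberField.discr K ∧
        (p = 3 → (primesEquiv v : ℕ) ≠ 3)))
    (h₀ : V.HasGoodReductionAtPrime p ∨ V.HasMultiplicativeReductionAtPrime p)
    (hfinV : V.ShaFinite) (hfinW : W.ShaFinite) :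
    padicValRat p (V.baseChange K).modifiedTamagawaProduct + padicValNat p (V.baseChange K).shaOrder +
        2 * padicValNat p V.torsionOrder + 2 * padicValNat p W.torsionOrder =
      padicValRat p |(C.u : ℚ)| + padicValNat p V.shaOrder + padicValNat p W.shaOrder +
        padicValNat p V.tamagawaProduct + padicValNat p W.tamagawaProduct +
        2 * padicValNat p (V.baseChange K).torsionOrder :=
  padicVal_card_identity_baseChange_anyRank_of_sumFibre K V W p h2 hdsq hC hp2
    (sumFibre_of_addv_oddPrime K V W p h2 hdodd hdsq hC hp2 hS) h₀ hfinV hfinW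

/-- **The rank-`(0,0)` valuation identity on S₃, every odd `p`, NO `hA`, NO Milne.**
[cite: Milne1972ArithmeticAV, §1 Thm. 1 and §2 (through DokchitserDokchitserAnnals2010, §2.1, proof of Thm. 8)]
[cite: DokchitserDokchitserAnnals2010, Lemma 4.14 (proof)] [cite: SilvermanAEC2009, Exercise 10.16] -/
theorem padicVal_card_identity_baseChange_of_addv_oddPrime (h2 : Module.finrank ℚ K = 2)
    (hdodd : Odd (NumberField.discr K)) (hdsq : Squarefree (NumberField.discr K))
    {C : VariableChange ℚ} (hC : C • V.quadraticTwist (NumberField.discr K : ℚ) = W) (hp2 : p ≠ 2)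
    (hS : ∀ v : HeightOneSpectrum (𝓞 ℚ), V.HasGoodReductionAt v ∨ V.HasMultiplicativeReductionAt v ∨
      (((primesEquiv v : ℕ) : ℤ) ∣ NumberField.discr K ∧ W.HasMultiplicativeReductionAt v) ∨
      (V.HasAdditiveReductionAt v ∧ ¬ ((primesEquiv v : ℕ) : ℤ) ∣ NumberField.discr K ∧
        (p = 3 → (primesEquiv v : ℕ) ≠ 3)))
    (h₀ : V.HasGoodReductionAtPrime p ∨ V.HasMultiplicativeReductionAtPrime p)
    [Finite V.toAffine.Point] [Finite W.toAffine.Point] (hfinV : V.ShaFinite) (hfinW : W.ShaFinite) :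
    padicValRat p ((V.baseChange K).modifiedTamagawaProduct * (V.baseChange K).shaOrder *
        (Nat.card V.toAffine.Point) ^ 2 * (Nat.card W.toAffine.Point) ^ 2 : ℚ) =
      padicValRat p ((V.baseChange ℝ).numRealComponents * |(C.u : ℚ)| * V.shaOrder * W.shaOrder *
        V.tamagawaProduct * W.tamagawaProduct * (Nat.card (V.baseChange K).toAffine.Point) ^ 2 : ℚ) :=
  padicVal_card_identity_baseChange_of_sumFibre K V W p h2 hdsq hC hp2
    (sumFibre_of_addv_oddPrime K V W p h2 hdodd hdsq hC hp2 hS) h₀ hfinV hfinW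

/-- **The ANY-RANK valuation identity with NO local population hypothesis** (`|d_K| = p`, `V` good
or multiplicative at `p`, `p` odd): e.g. `K = ℚ(ζ₃)`, `p = 3`, `V` good ordinary at `3` — the
currency of the ℚ(ζ₃) LOWER lines, Milne's A73 `hMilne` and A233 BOTH proved away, no `hS`.
[cite: Milne1972ArithmeticAV, §1 Thm. 1 and §2 (through DokchitserDokchitserAnnals2010, §2.1, proof of Thm. 8)]
[cite: DokchitserDokchitserAnnals2010, Lemma 4.14 (proof)] [cite: SilvermanAEC2009, Exercise 10.16] -/
theorem padicVal_card_identity_baseChange_anyRank_of_natAbs_discr_eq (h2 : Module.finrank ℚ K = 2)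
    {C : VariableChange ℚ} (hC : C • V.quadraticTwist (NumberField.discr K : ℚ) = W) (hp2 : p ≠ 2)
    (hdK : (NumberField.discr K).natAbs = p)
    (h₀ : V.HasGoodReductionAtPrime p ∨ V.HasMultiplicativeReductionAtPrime p)
    (hfinV : V.ShaFinite) (hfinW : W.ShaFinite) :
    padicValRat p (V.baseChange K).modifiedTamagawaProduct + padicValNat p (V.baseChange K).shaOrder +
        2 * padicValNat p V.torsionOrder + 2 * padicValNat p W.torsionOrder =
      padicValRat p |(C.u : ℚ)| + padicValNat p V.shaOrder + padicValNat p W.shaOrder +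
        padicValNat p V.tamagawaProduct + padicValNat p W.tamagawaProduct +
        2 * padicValNat p (V.baseChange K).torsionOrder :=
  padicVal_card_identity_baseChange_anyRank_of_sumFibre K V W p h2 (squarefree_discr_of_natAbs_eq K p hdK)
    hC hp2 (sumFibre_of_natAbs_discr_eq K V W p h2 hC hp2 hdK h₀) h₀ hfinV hfinW

/-- **The rank-`(0,0)` valuation identity with NO local population hypothesis** (`|d_K| = p`, `V`
good or multiplicative at `p`, `p` odd). [cite: Milne1972ArithmeticAV, §1 Thm. 1 and §2 (through DokchitserDokchitserAnnals2010, §2.1, proof of Thm. 8)]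
[cite: DokchitserDokchitserAnnals2010, Lemma 4.14 (proof)] [cite: SilvermanAEC2009, Exercise 10.16] -/
theorem padicVal_card_identity_baseChange_of_natAbs_discr_eq (h2 : Module.finrank ℚ K = 2)
    {C : VariableChange ℚ} (hC : C • V.quadraticTwist (NumberField.discr K : ℚ) = W) (hp2 : p ≠ 2)
    (hdK : (NumberField.discr K).natAbs = p)
    (h₀ : V.HasGoodReductionAtPrime p ∨ V.HasMultiplicativeReductionAtPrime p)
    [Finite V.toAffine.Point] [Finite W.toAffine.Point] (hfinV : V.ShaFinite) (hfinW : W.ShaFinite) :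
    padicValRat p ((V.baseChange K).modifiedTamagawaProduct * (V.baseChange K).shaOrder *
        (Nat.card V.toAffine.Point) ^ 2 * (Nat.card W.toAffine.Point) ^ 2 : ℚ) =
      padicValRat p ((V.baseChange ℝ).numRealComponents * |(C.u : ℚ)| * V.shaOrder * W.shaOrder *
        V.tamagawaProduct * W.tamagawaProduct * (Nat.card (V.baseChange K).toAffine.Point) ^ 2 : ℚ) :=
  padicVal_card_identity_baseChange_of_sumFibre K V W p h2 (squarefree_discr_of_natAbs_eq K p hdK) hC hp2
    (sumFibre_of_natAbs_discr_eq K V W p h2 hC hp2 hdK h₀) h₀ hfinV hfinW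

end OddPrime

end Summit.BirchSwinnertonDyer.Rank1Residual.Additive

end
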